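import Summits.BirchSwinnertonDyer.BirchSwinnertonDyer.Theorems.EisensteinDepletionAtTwoStarOptBNSFTwoAdicFlipEtale
import HarnessLib

/-!
# The 2-ADIC half of the h-invariant, ramified case: the 2-isogeny with RAMIFIED kernel lands on an ÉTALE dual kernel — explicit minimal model

Companion of `EisensteinDepletionAtTwoStarOptBNSFTwoAdicFlipEtale.lean` (support for the crux (★-OptB_NSF) `StarOptBNSF`, item
stmt-BirchSwinnertonDyer-27047, line `nsf`, stub `stub_regimeTransport`): the RAMIFIED ⟶ ÉTALE direction of the 2-adic flip in coordinates.

Let `W₀/ℤ` have odd discriminant and a rational 2-torsion point with `ξ = 4x` ODD (RAMIFIED at 2).  Then (`typeII`, `8 ∣ ξ + b₂`) the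
two-torsion normal form is `E = [0, 2A₁, 0, B, 0]` with `B` odd and `A₁ = 4γ + 3`, and — from `B²(A² − 4B) = 2⁸Δ(W₀)` — `A₁² − B = 64D`
with `D` odd (`normalForm_ramified`).  The codomain `E' = twoIsogenyCodomain E = [0, −4A₁, 0, 256D, 0]` is carried by
`(u, r, s, t) = (4, 0, 2, 0)` to the INTEGRAL model `M' = [1, −(γ+1), 0, D, 0]` (`smul_twoIsogenyCodomain_eq_dualModel'`) with ODD
discriminant `D²·B` (`odd_Δ_dualModel'`), on which the dual-kernel point `(0,0)` of `E'` stays `(0,0)`: abscissa `0`, NOT ramified at 2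
(`flip_ramified_to_etale`; `v₂(0) = 0` — cf. the tree's `GVITower.c579b1_notRam`).

HONEST FRAMING: coordinates only (minimal-model uniqueness and the isogeny-class walk are not here); nothing proves `StarOptBNSF`,
E1M_NSF or BSD.  References: J. Silverman, AEC III.1 Table 3.1, III.4 Example 4.5, VII.1 [SilvermanAEC2009]; W. Ivorra, Dissertationes
Math. 429 (2004) §2.1 [Ivorra2004]; R. Greenberg, LNM 1716 (1999) §5 [GreenbergLNM1716].
-/

set_option linter.dupNamespace false
set_option autoImplicit false

open Literature.NumberTheory.EllipticCurves Literature.NumberTheory.EllipticCurves.Greenberg1999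
  Literature.NumberTheory.EllipticCurves.PrimeConductorTwoTorsion
  Summit.BirchSwinnertonDyer.BirchSwinnertonDyer.Theorems.DepletionAtTwo.TwoAdic

namespace Summit.BirchSwinnertonDyer.BirchSwinnertonDyer.Theorems.DepletionAtTwo.TwoAdicFlip

/-! ## §1 The ramified normal form: `A = 2(4γ + 3)`, `B` odd, `A₁² − B = 64D`, `D` odd -/

/-- **The ramified normal form.** For `W₀/ℤ` with odd discriminant and an ODD integer root `ξ` (a RAMIFIED rational 2-torsion point):
`A = b₂ + 3ξ = 2(4γ + 3)`, `B = 3ξ² + 2b₂ξ + 8b₄` odd, and `(4γ+3)² − B = 64D` with `D` odd (`typeII` and `B²(A² − 4B) = 2⁸Δ`).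
[cite: Ivorra2004, §2.1] -/
theorem normalForm_ramified (W₀ : WeierstrassCurve ℤ) (hΔ : Odd W₀.Δ) {ξ : ℤ}
    (H : ξ ^ 3 + W₀.b₂ * ξ ^ 2 + 8 * W₀.b₄ * ξ + 16 * W₀.b₆ = 0) (hξ : Odd ξ) :
    ∃ γ D : ℤ, W₀.b₂ + 3 * ξ = 2 * (4 * γ + 3) ∧ (4 * γ + 3) ^ 2 - (3 * ξ ^ 2 + 2 * W₀.b₂ * ξ + 8 * W₀.b₄) = 64 * D ∧
      Odd (3 * ξ ^ 2 + 2 * W₀.b₂ * ξ + 8 * W₀.b₄) ∧ Odd D := by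
  have ha₁ : Odd W₀.a₁ := by
    rcases odd_a₁_or_odd_a₃_of_odd_Δ W₀ hΔ with h₁ | h₃
    · exact h₁
    · rcases Int.even_or_odd W₀.a₁ with h₁ | h₁
      · exact absurd H (no_root_of_even_a₁_odd_a₃ W₀ h₁ h₃ ξ)
      · exact h₁
  obtain ⟨e, he⟩ := b₂_eq_of_odd_a₁ W₀ ha₁
  have h8 : (8 : ℤ) ∣ ξ + W₀.b₂ := by
    rcases odd_or_four_dvd W₀.b₂ W₀.b₄ W₀.b₆ ξ ⟨4 * e + 2 * W₀.a₂, by rw [he]; ring⟩ H with ⟨-, h8⟩ | h4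
    · exact h8
    · exfalso
      obtain ⟨m, hm⟩ := hξ
      omega
  obtain ⟨hBodd, A₁, hA, hA₁⟩ := typeII W₀.b₂ W₀.b₄ W₀.a₂ e ξ he hξ h8
  set B := 3 * ξ ^ 2 + 2 * W₀.b₂ * ξ + 8 * W₀.b₄ with hBdef
  have hId := normalForm_Δ W₀ H
  rw [hA] at hId
  -- `B² (A₁² − B) = 64 Δ`
  have hId' : B ^ 2 * (A₁ ^ 2 - B) = 64 * W₀.Δ := by
    have : B ^ 2 * ((2 * A₁) ^ 2 - 4 * B) = 4 * (B ^ 2 * (A₁ ^ 2 - B)) := by ring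
    rw [this] at hId
    omega
  -- `64 ∣ A₁² − B` since `B` is odd
  have h2B : ¬ (2 : ℤ) ∣ B := by
    obtain ⟨m, hm⟩ := hBodd
    omega
  have hcop : IsCoprime ((2 : ℤ) ^ 6) (B ^ 2) :=
    ((Int.prime_two.irreducible.coprime_iff_not_dvd).mpr h2B).pow
  have h64 : (64 : ℤ) ∣ A₁ ^ 2 - B := by
    have h : (2 : ℤ) ^ 6 ∣ B ^ 2 * (A₁ ^ 2 - B) := ⟨W₀.Δ, by rw [hId']; norm_num⟩
    have := hcop.dvd_of_dvd_mul_left h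
    simpa using this
  obtain ⟨D, hD⟩ := h64
  have hDodd : Odd D := by
    have hBD : B ^ 2 * D = W₀.Δ := by
      have : B ^ 2 * (A₁ ^ 2 - B) = 64 * (B ^ 2 * D) := by rw [hD]; ring
      rw [this] at hId'
      omega
    have := hΔ
    rw [← hBD, Int.odd_mul] at this
    exact this.2
  refine ⟨(A₁ - 3) / 4, D, by omega, ?_, hBodd, hDodd⟩
  have hγ : 4 * ((A₁ - 3) / 4) + 3 = A₁ := by omega
  rw [hγ]
  exact hD

/-! ## §2 The dual model `M' = [1, −(γ+1), 0, D, 0]` and its étale point `(0, 0)` -/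

/-- **`(u, r, s, t) = (4, 0, 2, 0)` carries `E' = twoIsogenyCodomain [0, 2(4γ+3), 0, (4γ+3)² − 64D, 0] = [0, −4(4γ+3), 0, 256D, 0]`
to `M'(γ, D) ⊗ ℚ`, `M'(γ, D) := [1, −(γ+1), 0, D, 0]`.** [cite: SilvermanAEC2009, III.1 Table 3.1 and III.4 Example 4.5] -/
theorem smul_twoIsogenyCodomain_eq_dualModel' (γ D : ℤ) :
    (⟨⟨4, 1 / 4, by norm_num, by norm_num⟩, 0, 2, 0⟩ : WeierstrassCurve.VariableChange ℚ) •
        WeierstrassCurve.twoIsogenyCodomain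
          (⟨0, 2 * (4 * (γ : ℚ) + 3), 0, (4 * (γ : ℚ) + 3) ^ 2 - 64 * (D : ℚ), 0⟩ : WeierstrassCurve ℚ) =
      (⟨1, -(γ + 1), 0, D, 0⟩ : WeierstrassCurve ℤ).baseChange ℚ := by
  have hu : ((((⟨4, 1 / 4, by norm_num, by norm_num⟩ : ℚˣ)⁻¹ : ℚˣ) : ℚ)) = 1 / 4 := rfl
  ext
  · rw [WeierstrassCurve.variableChange_a₁, hu]; simp [WeierstrassCurve.twoIsogenyCodomain, WeierstrassCurve.baseChange]; norm_num
  · rw [WeierstrassCurve.variableChange_a₂, hu]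
    simp [WeierstrassCurve.twoIsogenyCodomain, WeierstrassCurve.baseChange]; ring
  · rw [WeierstrassCurve.variableChange_a₃, hu]
    simp [WeierstrassCurve.twoIsogenyCodomain, WeierstrassCurve.baseChange]
  · rw [WeierstrassCurve.variableChange_a₄, hu]
    simp [WeierstrassCurve.twoIsogenyCodomain, WeierstrassCurve.baseChange]; ring
  · rw [WeierstrassCurve.variableChange_a₆, hu]
    simp [WeierstrassCurve.twoIsogenyCodomain, WeierstrassCurve.baseChange]

/-- **`Δ(M') = D²·((4γ+3)² − 64D)`** (`= D²B`, odd when `B`, `D` are). [cite: SilvermanAEC2009, III.1 (Δ)] -/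
theorem Δ_dualModel' (γ D : ℤ) :
    (⟨1, -(γ + 1), 0, D, 0⟩ : WeierstrassCurve ℤ).Δ = D ^ 2 * ((4 * γ + 3) ^ 2 - 64 * D) := by
  simp only [WeierstrassCurve.Δ, WeierstrassCurve.b₂, WeierstrassCurve.b₄, WeierstrassCurve.b₆, WeierstrassCurve.b₈]
  ring

/-- `Δ(M')` is odd when `D` and `B = (4γ+3)² − 64D` are. [folklore] -/
theorem odd_Δ_dualModel' (γ D : ℤ) (hD : Odd D) (hB : Odd ((4 * γ + 3) ^ 2 - 64 * D)) :
    Odd (⟨1, -(γ + 1), 0, D, 0⟩ : WeierstrassCurve ℤ).Δ := by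
  rw [Δ_dualModel']
  exact Int.odd_mul.mpr ⟨Int.odd_pow.mpr (Or.inl hD), hB⟩

/-- **The dual-kernel point on `M'`**: `(0, 0)` is a rational point of order 2 of `M' ⊗ ℚ` (the image of `(0,0) ∈ E'` under `(4, 0, 2, 0)`).
[cite: SilvermanAEC2009, III.4 Example 4.5] -/
theorem hasRationalTwoTorsionX_dualModel' (γ D : ℤ) :
    HasRationalTwoTorsionX ((⟨1, -(γ + 1), 0, D, 0⟩ : WeierstrassCurve ℤ).baseChange ℚ) 0 := by
  refine ⟨0, ?_, ?_⟩
  · rw [WeierstrassCurve.Affine.equation_iff]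
    simp [WeierstrassCurve.baseChange]
  · simp [WeierstrassCurve.baseChange]

/-! ## §3 Assembly -/

/-- **THE 2-ADIC FLIP, RAMIFIED ⟶ ÉTALE (explicit).**  Let `W₀/ℤ` have odd discriminant and a rational 2-torsion point `x₀` of `W₀ ⊗ ℚ`
RAMIFIED at 2.  Then there are integers `γ`, `D` (`D` odd, `B = (4γ+3)² − 64D` odd) such that the two-torsion normal form of
`(W₀, x₀)` is `E = [0, 2(4γ+3), 0, B, 0]`, the codomain `E' = twoIsogenyCodomain E` is carried by `(4, 0, 2, 0)` to the integral model
`M' = [1, −(γ+1), 0, D, 0]` with ODD discriminant, and the dual-kernel point of `M' ⊗ ℚ` has abscissa `0`, NOT ramified at 2.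
[cite: SilvermanAEC2009, III.4 Example 4.5, VII.1] [cite: GreenbergLNM1716, §5] -/
theorem flip_ramified_to_etale (W₀ : WeierstrassCurve ℤ) (hΔ : Odd W₀.Δ) {x₀ : ℚ}
    (hx₀ : HasRationalTwoTorsionX (W₀.baseChange ℚ) x₀) (hram : TwoTorsionRamifiedAtTwo x₀) :
    ∃ (γ D : ℤ) (y₀ : ℚ), Odd D ∧ Odd ((4 * γ + 3) ^ 2 - 64 * D) ∧
      (W₀.baseChange ℚ).toAffine.Equation x₀ y₀ ∧ 2 * y₀ + (W₀.baseChange ℚ).a₁ * x₀ + (W₀.baseChange ℚ).a₃ = 0 ∧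
      (⟨⟨1 / 2, 2, by norm_num, by norm_num⟩, x₀, -(W₀.baseChange ℚ).a₁ / 2, y₀⟩ : WeierstrassCurve.VariableChange ℚ) •
          W₀.baseChange ℚ = ⟨0, 2 * (4 * (γ : ℚ) + 3), 0, (4 * (γ : ℚ) + 3) ^ 2 - 64 * (D : ℚ), 0⟩ ∧
      (⟨⟨4, 1 / 4, by norm_num, by norm_num⟩, 0, 2, 0⟩ : WeierstrassCurve.VariableChange ℚ) •
          WeierstrassCurve.twoIsogenyCodomain
            (⟨0, 2 * (4 * (γ : ℚ) + 3), 0, (4 * (γ : ℚ) + 3) ^ 2 - 64 * (D : ℚ), 0⟩ : WeierstrassCurve ℚ) =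
        (⟨1, -(γ + 1), 0, D, 0⟩ : WeierstrassCurve ℤ).baseChange ℚ ∧
      Odd (⟨1, -(γ + 1), 0, D, 0⟩ : WeierstrassCurve ℤ).Δ ∧
      HasRationalTwoTorsionX ((⟨1, -(γ + 1), 0, D, 0⟩ : WeierstrassCurve ℤ).baseChange ℚ) 0 ∧ ¬ TwoTorsionRamifiedAtTwo (0 : ℚ) := by
  have hb : Odd W₀.b₂ := odd_b₂_of_odd_Δ_of_hasRationalTwoTorsionX W₀ hΔ hx₀
  obtain ⟨ξ, hξ, H, hiff⟩ := exists_four_mul_and_ramified_iff_odd W₀ hb hx₀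
  have hodd : Odd ξ := hiff.mp hram
  obtain ⟨γ, D, hA, hD, hBodd, hDodd⟩ := normalForm_ramified W₀ hΔ H hodd
  have hB : 3 * ξ ^ 2 + 2 * W₀.b₂ * ξ + 8 * W₀.b₄ = (4 * γ + 3) ^ 2 - 64 * D := by linarith
  have hBodd' : Odd ((4 * γ + 3) ^ 2 - 64 * D) := hB ▸ hBodd
  obtain ⟨y₀, heq, h2⟩ := hx₀
  refine ⟨γ, D, y₀, hDodd, hBodd', heq, h2, ?_, smul_twoIsogenyCodomain_eq_dualModel' γ D, odd_Δ_dualModel' γ D hDodd hBodd',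
    hasRationalTwoTorsionX_dualModel' γ D, by rw [twoTorsionRamifiedAtTwo_iff]; simp⟩
  rw [smul_eq_twoTorsionModel (W₀.baseChange ℚ) heq h2]
  have hb₂ : (W₀.baseChange ℚ).b₂ = (W₀.b₂ : ℚ) := by simp [WeierstrassCurve.baseChange]
  have hb₄ : (W₀.baseChange ℚ).b₄ = (W₀.b₄ : ℚ) := by simp [WeierstrassCurve.baseChange]
  have hx : (4 : ℚ) * x₀ = ξ := by rw [hξ]
  rw [hb₂, hb₄, hx]
  have hA' : ((W₀.b₂ : ℚ) + 3 * ξ) = 2 * (4 * γ + 3) := by exact_mod_cast hA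
  have hB' : (3 * (ξ : ℚ) ^ 2 + 2 * W₀.b₂ * ξ + 8 * W₀.b₄) = (4 * γ + 3) ^ 2 - 64 * D := by exact_mod_cast hB
  rw [hA', hB']

end Summit.BirchSwinnertonDyer.BirchSwinnertonDyer.Theorems.DepletionAtTwo.TwoAdicFlip
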